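import Mathlib.MeasureTheory.Measure.Portmanteau
import Mathlib.Topology.UniformSpace.LocallyUniformConvergence
import Literature.Probability.LatticeModels.IsingLimitLaw
import Literature.NumberTheory.LFunctions.XiHeatRayGaussian
import HarnessLib

/-!
# Laplace transforms along Ising limits

Trunk T-STATMECH (`Literature/Probability/LatticeModels`), analytic half of the discharge of the
named fact `hasLeeYangProperty_of_isIsingLimitLaw` (Newman 1974, Thm. 3), see
`IsingLimitLawClosure.lean`. For probability measures `ν_k → ν` weakly on `ℝ` with a uniform
Gaussian-exponential moment bound `∫ e^{u²} dν_k ≤ C` (the moment clause of `IsIsingLimitLaw` at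
`b = 1`):

* `integrable_exp_mul_sq_of_tendsto` — the bound passes to the limit (portmanteau, lower
  semicontinuity of open-set masses);
* `tendsto_integral_of_tendsto_of_exp_sq_bound` — `∫ g dν_k → ∫ g dν` for every continuous
  `g : ℝ → ℂ` with `‖g(u)‖ ≤ e^{A|u|}` (continuous truncation, tails `≤ e^{-(R-|A|)R} C`);
* `tendsto_integral_cexp_of_tendsto`, `tendstoLocallyUniformlyOn_integral_cexp` — the Laplace
  transforms `z ↦ ∫ e^{zu} dν_k` converge pointwise and locally uniformly on `ℂ` (equi-Lipschitz
  bounds on balls from the `e^{u²}`-moment, then a finite-net argument on compact sets);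
* `integrable_isingMagnetizationLaw` — everything is integrable against a finite magnetization law.

The inequality `‖e^z − 1‖ ≤ ‖z‖e^{‖z‖}` is reused from `XiHeatRayGaussian.lean`
(`Literature.NumberTheory.LFunctions.norm_cexp_sub_one_le_mul_exp`).

## References

* C. M. Newman, *Zeros of the partition function for generalized Ising systems*, CPAM 27 (1974)
  143–159, proof of Thm. 3.
* E. H. Lieb, A. D. Sokal, CMP 80 (1981) 153–179, §2.
-/

noncomputable section

open MeasureTheory Filter Topology Complex Set Metric

namespace Literature.Probability.LatticeModels

/-! ### Analytic lemmas -/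

/-- `e^{A|u|} ≤ e^{A²/4} e^{u²}`. [folklore] -/
theorem exp_mul_abs_le (A u : ℝ) : Real.exp (A * |u|) ≤ Real.exp (A ^ 2 / 4) * Real.exp (u ^ 2) := by
  rw [← Real.exp_add]
  refine Real.exp_le_exp.2 ?_
  have habs : |u| ^ 2 = u ^ 2 := sq_abs u
  nlinarith [sq_nonneg (|u| - A / 2)]

/-- Pointwise Lipschitz bound for the Laplace kernel on the ball of radius `B`:
`‖e^{zu} - e^{z'u}‖ ≤ ‖z - z'‖ · e^{(3B+1)²/4} · e^{u²}` for `‖z‖, ‖z'‖ ≤ B`. [folklore] -/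
theorem norm_cexp_mul_sub_cexp_mul_le {B : ℝ} {z z' : ℂ} (hz : ‖z‖ ≤ B)
    (hz' : ‖z'‖ ≤ B) (u : ℝ) :
    ‖cexp (z * u) - cexp (z' * u)‖ ≤
      ‖z - z'‖ * (Real.exp ((3 * B + 1) ^ 2 / 4) * Real.exp (u ^ 2)) := by
  have hfac : cexp (z * u) - cexp (z' * u) = cexp (z' * u) * (cexp ((z - z') * u) - 1) := by
    rw [mul_sub, mul_one, ← Complex.exp_add]; ring_nf
  rw [hfac, norm_mul, Complex.norm_exp]
  have hre : (z' * (u : ℂ)).re ≤ B * |u| := by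
    rw [Complex.re_mul_ofReal]
    calc z'.re * u ≤ |z'.re * u| := le_abs_self _
      _ = |z'.re| * |u| := abs_mul _ _
      _ ≤ B * |u| := by gcongr; exact (Complex.abs_re_le_norm z').trans hz'
  have h1 : Real.exp ((z' * (u : ℂ)).re) ≤ Real.exp (B * |u|) := Real.exp_le_exp.2 hre
  have hzz' : ‖z - z'‖ ≤ 2 * B := (norm_sub_le z z').trans (by linarith)
  have hw : ‖(z - z') * (u : ℂ)‖ = ‖z - z'‖ * |u| := by
    rw [norm_mul, Complex.norm_real, Real.norm_eq_abs]
  have h2 : ‖cexp ((z - z') * u) - 1‖ ≤ ‖z - z'‖ * |u| * Real.exp (2 * B * |u|) := by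
    refine (Literature.NumberTheory.LFunctions.norm_cexp_sub_one_le_mul_exp _).trans ?_
    rw [hw]
    have hle : ‖z - z'‖ * |u| ≤ 2 * B * |u| := mul_le_mul_of_nonneg_right hzz' (abs_nonneg u)
    exact mul_le_mul_of_nonneg_left (Real.exp_le_exp.2 hle) (by positivity)
  have h3 : |u| ≤ Real.exp |u| := by linarith [Real.add_one_le_exp |u|]
  calc Real.exp ((z' * (u : ℂ)).re) * ‖cexp ((z - z') * u) - 1‖
      ≤ Real.exp (B * |u|) * (‖z - z'‖ * |u| * Real.exp (2 * B * |u|)) := by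
        gcongr
    _ ≤ Real.exp (B * |u|) * (‖z - z'‖ * Real.exp |u| * Real.exp (2 * B * |u|)) := by
        gcongr
    _ = ‖z - z'‖ * Real.exp ((3 * B + 1) * |u|) := by
        have : Real.exp ((3 * B + 1) * |u|) = Real.exp (B * |u|) * Real.exp |u| *
            Real.exp (2 * B * |u|) := by
          rw [← Real.exp_add, ← Real.exp_add]; ring_nf
        rw [this]; ring
    _ ≤ ‖z - z'‖ * (Real.exp ((3 * B + 1) ^ 2 / 4) * Real.exp (u ^ 2)) := by
        gcongr; exact exp_mul_abs_le _ _

/-- On a compact set, an equi-Lipschitz sequence that converges pointwise converges uniformly.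
[folklore] -/
theorem tendstoUniformlyOn_of_lipschitz_of_tendsto {F : ℕ → ℂ → ℂ} {f : ℂ → ℂ} {K : Set ℂ}
    (hK : IsCompact K) {L : ℝ} (hL : 0 < L)
    (hF : ∀ k, ∀ z ∈ K, ∀ z' ∈ K, dist (F k z) (F k z') ≤ L * dist z z')
    (h : ∀ z ∈ K, Tendsto (fun k => F k z) atTop (𝓝 (f z))) : TendstoUniformlyOn F f atTop K := by
  -- the limit is Lipschitz on `K` as well
  have hf : ∀ z ∈ K, ∀ z' ∈ K, dist (f z) (f z') ≤ L * dist z z' := fun z hz z' hz' =>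
    le_of_tendsto ((h z hz).dist (h z' hz')) (Eventually.of_forall fun k => hF k z hz z' hz')
  refine Metric.tendstoUniformlyOn_iff.2 fun ε hε => ?_
  set δ : ℝ := ε / 3 / L with hδ
  have hδpos : 0 < δ := by positivity
  obtain ⟨t, htK, htfin, hcover⟩ := finite_cover_balls_of_compact hK hδpos
  have hev : ∀ᶠ k in atTop, ∀ x ∈ t, dist (F k x) (f x) < ε / 3 :=
    (eventually_all_finite htfin).2 fun x hx => Metric.tendsto_nhds.1 (h x (htK hx)) _ (by positivity)
  filter_upwards [hev] with k hk z hz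
  obtain ⟨x, hxt, hzx⟩ := Set.mem_iUnion₂.1 (hcover hz)
  have hxK := htK hxt
  have hzx' : dist z x < δ := mem_ball.1 hzx
  have hLδ : L * δ = ε / 3 := by rw [hδ]; field_simp
  calc dist (f z) (F k z) ≤ dist (f z) (f x) + dist (f x) (F k x) + dist (F k x) (F k z) :=
        dist_triangle4 _ _ _ _
    _ < ε / 3 + ε / 3 + ε / 3 := by
        gcongr
        · calc dist (f z) (f x) ≤ L * dist z x := hf z hz x hxK
            _ < L * δ := by gcongr
            _ = ε / 3 := hLδ
        · rw [dist_comm]; exact hk x hxt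
        · calc dist (F k x) (F k z) ≤ L * dist x z := hF k x hxK z hz
            _ < L * δ := by rw [dist_comm]; gcongr
            _ = ε / 3 := hLδ
    _ = ε := by ring

/-! ### Integrability against magnetization laws and against Ising limit laws -/

/-- Every (strongly measurable) function is integrable against a finite magnetization law (a finite
mixture of Dirac masses). [folklore] -/
theorem integrable_isingMagnetizationLaw {n : ℕ} (J : Fin n → Fin n → ℝ) (w : Fin n → ℝ)
    {E : Type*} [NormedAddCommGroup E] {f : ℝ → E} (hf : StronglyMeasurable f) :
    Integrable f (isingMagnetizationLaw n J w : Measure ℝ) := by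
  have hmeas := measurable_of_config (weightedMagnetization w)
  change Integrable f ((isingPairPMF J).map (weightedMagnetization w)).toMeasure
  rw [← PMF.toMeasure_map (weightedMagnetization w) (isingPairPMF J) hmeas,
    integrable_map_measure hf.aestronglyMeasurable hmeas.aemeasurable]
  exact Integrable.of_finite

/-- The Gaussian-exponential moment bound passes to the weak limit:
`∫⁻ e^{b u²} dν ≤ C` whenever `∫ e^{b u²} dν_k ≤ C` along a sequence of magnetization laws converging
to `ν` (lower semicontinuity of open-set masses, portmanteau). [folklore] -/
theorem lintegral_exp_mul_sq_le_of_tendsto {νs : ℕ → ProbabilityMeasure ℝ} {ν : ProbabilityMeasure ℝ}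
    (hlim : Tendsto νs atTop (𝓝 ν)) {b C : ℝ}
    (hint : ∀ k, Integrable (fun u => Real.exp (b * u ^ 2)) (νs k : Measure ℝ))
    (hC : ∀ k, ∫ u, Real.exp (b * u ^ 2) ∂(νs k : Measure ℝ) ≤ C) :
    ∫⁻ u, ENNReal.ofReal (Real.exp (b * u ^ 2)) ∂(ν : Measure ℝ) ≤ ENNReal.ofReal C := by
  have hcont : Continuous fun u : ℝ => Real.exp (b * u ^ 2) := by fun_prop
  have h1 := lintegral_le_liminf_lintegral_of_forall_isOpen_measure_le_liminf_measure
    (μ := (ν : Measure ℝ)) (μs := fun k => (νs k : Measure ℝ)) hcont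
    (fun u => (Real.exp_pos _).le)
    (fun G hG => ProbabilityMeasure.le_liminf_measure_open_of_tendsto hlim hG)
  refine h1.trans (liminf_le_of_le (by isBoundedDefault) fun a ha => ?_)
  obtain ⟨k, hk⟩ := ha.exists
  refine hk.trans ?_
  rw [← ofReal_integral_eq_lintegral_ofReal (hint k) (Eventually.of_forall fun u => (Real.exp_pos _).le)]
  exact ENNReal.ofReal_le_ofReal (hC k)

/-- Hence `e^{b u²}` is integrable against the limit, with the same bound. [folklore] -/
theorem integrable_exp_mul_sq_of_tendsto {νs : ℕ → ProbabilityMeasure ℝ} {ν : ProbabilityMeasure ℝ}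
    (hlim : Tendsto νs atTop (𝓝 ν)) {b C : ℝ}
    (hint : ∀ k, Integrable (fun u => Real.exp (b * u ^ 2)) (νs k : Measure ℝ))
    (hC : ∀ k, ∫ u, Real.exp (b * u ^ 2) ∂(νs k : Measure ℝ) ≤ C) :
    Integrable (fun u => Real.exp (b * u ^ 2)) (ν : Measure ℝ) ∧
      ∫ u, Real.exp (b * u ^ 2) ∂(ν : Measure ℝ) ≤ C := by
  have hcont : Continuous fun u : ℝ => Real.exp (b * u ^ 2) := by fun_prop
  have hle := lintegral_exp_mul_sq_le_of_tendsto hlim hint hC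
  have hlt : ∫⁻ u, ENNReal.ofReal (Real.exp (b * u ^ 2)) ∂(ν : Measure ℝ) < ⊤ :=
    hle.trans_lt ENNReal.ofReal_lt_top
  have hI : Integrable (fun u => Real.exp (b * u ^ 2)) (ν : Measure ℝ) :=
    ⟨hcont.aestronglyMeasurable,
      (hasFiniteIntegral_iff_ofReal (Eventually.of_forall fun u => (Real.exp_pos _).le)).2 hlt⟩
  refine ⟨hI, ?_⟩
  have hC0 : 0 ≤ C := le_trans (integral_nonneg fun u => (Real.exp_pos _).le) (hC 0)
  rw [← ENNReal.ofReal_le_ofReal_iff hC0, ofReal_integral_eq_lintegral_ofReal hI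
    (Eventually.of_forall fun u => (Real.exp_pos _).le)]
  exact hle


/-! ### Convergence of integrals of exponentially bounded test functions -/

/-- Tail estimate: for `|A| ≤ R < |u|`, `e^{A|u|} ≤ e^{-(R-|A|)R} e^{u²}`. [folklore] -/
theorem exp_mul_abs_le_of_lt {A R u : ℝ} (hAR : |A| ≤ R) (hu : R < |u|) :
    Real.exp (A * |u|) ≤ Real.exp (-((R - |A|) * R)) * Real.exp (u ^ 2) := by
  rw [← Real.exp_add]
  refine Real.exp_le_exp.2 ?_
  have h1 : A * |u| ≤ |A| * |u| := mul_le_mul_of_nonneg_right (le_abs_self A) (abs_nonneg u)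
  have hsq : |u| ^ 2 = u ^ 2 := sq_abs u
  have hprod : 0 ≤ (|u| - R) * (|u| + R - |A|) :=
    mul_nonneg (sub_nonneg.2 hu.le) (by linarith [abs_nonneg A])
  nlinarith

/-- **Weak convergence with Gaussian-exponential moment control integrates exponentially bounded
continuous functions**: if `ν_k → ν` weakly and `∫ e^{u²} dν_k ≤ C`, then `∫ g dν_k → ∫ g dν` for
every continuous `g : ℝ → ℂ` with `‖g(u)‖ ≤ e^{A|u|}` (truncate with a continuous cutoff, control the
tails uniformly by `e^{-(R-|A|)R} C`). [Newman 1974, proof of Thm. 3] [folklore] -/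
theorem tendsto_integral_of_tendsto_of_exp_sq_bound {νs : ℕ → ProbabilityMeasure ℝ}
    {ν : ProbabilityMeasure ℝ} (hlim : Tendsto νs atTop (𝓝 ν)) {C : ℝ}
    (hint : ∀ k, Integrable (fun u => Real.exp (u ^ 2)) (νs k : Measure ℝ))
    (hC : ∀ k, ∫ u, Real.exp (u ^ 2) ∂(νs k : Measure ℝ) ≤ C)
    {g : ℝ → ℂ} (hg : Continuous g) {A : ℝ} (hgA : ∀ u, ‖g u‖ ≤ Real.exp (A * |u|)) :
    Tendsto (fun k => ∫ u, g u ∂(νs k : Measure ℝ)) atTop (𝓝 (∫ u, g u ∂(ν : Measure ℝ))) := by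
  -- moment bound and integrability for the limit
  obtain ⟨hIν, hCν⟩ : Integrable (fun u => Real.exp (u ^ 2)) (ν : Measure ℝ) ∧
      ∫ u, Real.exp (u ^ 2) ∂(ν : Measure ℝ) ≤ C := by
    have h := integrable_exp_mul_sq_of_tendsto hlim (b := 1) (C := C)
      (fun k => by simpa only [one_mul] using hint k) (fun k => by simpa only [one_mul] using hC k)
    simpa only [one_mul] using h
  -- `C ≥ 1 > 0`
  have hCpos : 0 < C := by
    have h1 : (1 : ℝ) ≤ ∫ u, Real.exp (u ^ 2) ∂(νs 0 : Measure ℝ) := by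
      have := integral_mono (integrable_const (1 : ℝ)) (hint 0)
        (fun u => by simpa using Real.one_le_exp (sq_nonneg u))
      simpa using this
    linarith [hC 0]
  -- domination `‖g‖ ≤ e^{A²/4} e^{u²}` and integrability of `g`
  have hdom : ∀ u, ‖g u‖ ≤ Real.exp (A ^ 2 / 4) * Real.exp (u ^ 2) :=
    fun u => (hgA u).trans (exp_mul_abs_le A u)
  have hgν : Integrable g (ν : Measure ℝ) :=
    (hIν.const_mul _).mono' hg.aestronglyMeasurable (Eventually.of_forall hdom)
  have hgk : ∀ k, Integrable g (νs k : Measure ℝ) := fun k =>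
    ((hint k).const_mul _).mono' hg.aestronglyMeasurable (Eventually.of_forall hdom)
  refine Metric.tendsto_atTop.2 fun ε hε => ?_
  -- choice of the truncation radius
  set Lg : ℝ := max 0 (Real.log (3 * C / ε)) with hLg
  set R : ℝ := |A| + 1 + Lg with hR
  have hLg0 : 0 ≤ Lg := le_max_left _ _
  have hAR : |A| ≤ R := by rw [hR]; linarith [abs_nonneg A]
  have hR1 : 1 ≤ R := by rw [hR]; linarith [abs_nonneg A]
  have htail : Real.exp (-((R - |A|) * R)) * C ≤ ε / 3 := by
    have h1 : Lg ≤ (R - |A|) * R := by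
      have : R - |A| = 1 + Lg := by rw [hR]; ring
      rw [this]; nlinarith
    have h2 : Real.exp (-((R - |A|) * R)) ≤ Real.exp (-Lg) := Real.exp_le_exp.2 (by linarith)
    have h3 : Real.exp (-Lg) ≤ ε / (3 * C) := by
      have : Real.log (3 * C / ε) ≤ Lg := le_max_right _ _
      calc Real.exp (-Lg) ≤ Real.exp (-Real.log (3 * C / ε)) :=
            Real.exp_le_exp.2 (neg_le_neg this)
        _ = (3 * C / ε)⁻¹ := by rw [Real.exp_neg, Real.exp_log (by positivity)]
        _ = ε / (3 * C) := by rw [inv_div]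
    calc Real.exp (-((R - |A|) * R)) * C ≤ ε / (3 * C) * C := by gcongr; exact h2.trans h3
      _ = ε / 3 := by field_simp
  -- the cutoff and the truncated test function
  set χ : ℝ → ℝ := fun u => max 0 (min 1 (R + 1 - |u|)) with hχ
  have hχc : Continuous χ := continuous_const.max (continuous_const.min (continuous_const.sub continuous_abs))
  have hχ0 : ∀ u, 0 ≤ χ u := fun u => le_max_left _ _
  have hχ1 : ∀ u, χ u ≤ 1 := fun u => max_le zero_le_one (min_le_left _ _)
  have hχR : ∀ u, |u| ≤ R → χ u = 1 := fun u hu => by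
    rw [hχ]; dsimp only; rw [min_eq_left (by linarith), max_eq_right zero_le_one]
  have hχR' : ∀ u, R + 1 ≤ |u| → χ u = 0 := fun u hu => by
    rw [hχ]; dsimp only; rw [max_eq_left]; exact min_le_of_right_le (by linarith)
  have hbound : ∀ u, ‖(χ u : ℂ) * g u‖ ≤ Real.exp (|A| * (R + 1)) := by
    intro u
    rw [norm_mul, Complex.norm_real, Real.norm_of_nonneg (hχ0 u)]
    rcases le_or_gt (|u|) (R + 1) with hu | hu
    · calc χ u * ‖g u‖ ≤ 1 * Real.exp (A * |u|) := by
            gcongr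
            · exact hχ1 u
            · exact hgA u
        _ ≤ Real.exp (|A| * (R + 1)) := by
            rw [one_mul]; refine Real.exp_le_exp.2 ?_
            calc A * |u| ≤ |A| * |u| := mul_le_mul_of_nonneg_right (le_abs_self A) (abs_nonneg u)
              _ ≤ |A| * (R + 1) := by gcongr
    · rw [hχR' u hu.le, zero_mul]; positivity
  set f : BoundedContinuousFunction ℝ ℂ := BoundedContinuousFunction.ofNormedAddCommGroup
    (fun u => (χ u : ℂ) * g u) (by fun_prop) _ hbound with hf
  have hfapply : ∀ u, f u = (χ u : ℂ) * g u := fun u => rfl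
  -- weak convergence on the truncated part
  have hweak := (ProbabilityMeasure.tendsto_iff_forall_integral_rclike_tendsto ℂ).1 hlim f
  obtain ⟨N, hN⟩ := Metric.tendsto_atTop.1 hweak (ε / 3) (by positivity)
  refine ⟨N, fun k hk => ?_⟩
  -- tail control, uniformly in the measure
  have htailμ : ∀ (μ : Measure ℝ) [IsProbabilityMeasure μ], Integrable (fun u => Real.exp (u ^ 2)) μ →
      Integrable g μ → ∫ u, Real.exp (u ^ 2) ∂μ ≤ C →
        ‖∫ u, (g u - f u) ∂μ‖ ≤ ε / 3 := by
    intro μ _ hIμ hgμ hCμ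
    have hpt : ∀ u, ‖g u - f u‖ ≤ Real.exp (-((R - |A|) * R)) * Real.exp (u ^ 2) := by
      intro u
      have : g u - f u = ((1 - χ u : ℝ) : ℂ) * g u := by rw [hfapply]; push_cast; ring
      rw [this, norm_mul, Complex.norm_real, Real.norm_of_nonneg (by linarith [hχ1 u])]
      rcases le_or_gt (|u|) R with hu | hu
      · rw [hχR u hu, sub_self, zero_mul]; positivity
      · calc (1 - χ u) * ‖g u‖ ≤ 1 * Real.exp (A * |u|) := by
              gcongr
              · linarith [hχ0 u]
              · exact hgA u
          _ ≤ Real.exp (-((R - |A|) * R)) * Real.exp (u ^ 2) := by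
              rw [one_mul]; exact exp_mul_abs_le_of_lt hAR hu
    calc ‖∫ u, (g u - f u) ∂μ‖ ≤ ∫ u, ‖g u - f u‖ ∂μ := norm_integral_le_integral_norm _
      _ ≤ ∫ u, Real.exp (-((R - |A|) * R)) * Real.exp (u ^ 2) ∂μ :=
          integral_mono (hgμ.sub (f.integrable μ)).norm (hIμ.const_mul _) hpt
      _ = Real.exp (-((R - |A|) * R)) * ∫ u, Real.exp (u ^ 2) ∂μ := integral_const_mul _ _
      _ ≤ Real.exp (-((R - |A|) * R)) * C := by gcongr
      _ ≤ ε / 3 := htail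
  have hsplit : ∀ (μ : Measure ℝ) [IsProbabilityMeasure μ], Integrable g μ →
      ∫ u, g u ∂μ = ∫ u, f u ∂μ + ∫ u, (g u - f u) ∂μ := by
    intro μ _ hgμ
    have h1 : ∫ u, g u ∂μ = ∫ u, (f u + (g - ⇑f) u) ∂μ :=
      integral_congr_ae (Eventually.of_forall fun u => by simp)
    rw [h1, integral_add (f.integrable μ) (hgμ.sub (f.integrable μ))]
    simp only [Pi.sub_apply]
  rw [dist_eq_norm, hsplit _ (hgk k), hsplit _ hgν]
  have hk' := hN k hk
  rw [dist_eq_norm] at hk'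
  calc ‖∫ u, f u ∂(νs k : Measure ℝ) + ∫ u, (g u - f u) ∂(νs k : Measure ℝ) -
        (∫ u, f u ∂(ν : Measure ℝ) + ∫ u, (g u - f u) ∂(ν : Measure ℝ))‖
      = ‖(∫ u, f u ∂(νs k : Measure ℝ) - ∫ u, f u ∂(ν : Measure ℝ)) +
          ∫ u, (g u - f u) ∂(νs k : Measure ℝ) - ∫ u, (g u - f u) ∂(ν : Measure ℝ)‖ := by
        congr 1; abel
    _ ≤ ‖∫ u, f u ∂(νs k : Measure ℝ) - ∫ u, f u ∂(ν : Measure ℝ)‖ +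
          ‖∫ u, (g u - f u) ∂(νs k : Measure ℝ)‖ + ‖∫ u, (g u - f u) ∂(ν : Measure ℝ)‖ :=
        norm_sub_le_of_le (norm_add_le _ _) le_rfl
    _ < ε / 3 + ε / 3 + ε / 3 := by
        have h1 := htailμ (νs k : Measure ℝ) (hint k) (hgk k) (hC k)
        have h2 := htailμ (ν : Measure ℝ) hIν hgν hCν
        linarith
    _ = ε := by ring


/-! ### Laplace transforms along an Ising limit -/

/-- `e^{u²}` is integrable against every finite magnetization law. [folklore] -/
theorem integrable_exp_sq_isingMagnetizationLaw {n : ℕ} (J : Fin n → Fin n → ℝ) (w : Fin n → ℝ) :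
    Integrable (fun u : ℝ => Real.exp (u ^ 2)) (isingMagnetizationLaw n J w : Measure ℝ) :=
  integrable_isingMagnetizationLaw J w (by fun_prop : Continuous fun u : ℝ => Real.exp (u ^ 2)).stronglyMeasurable

/-- The Laplace kernel is bounded by `e^{|Re z| |u|}`. [folklore] -/
theorem norm_cexp_mul_ofReal_le (z : ℂ) (u : ℝ) : ‖cexp (z * u)‖ ≤ Real.exp (|z.re| * |u|) := by
  rw [Complex.norm_exp, Complex.re_mul_ofReal]
  exact Real.exp_le_exp.2 ((le_abs_self _).trans (abs_mul _ _).le)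

/-- **Laplace transforms converge along an Ising limit**: if magnetization laws `ν_k → ν` weakly with
`∫ e^{u²} dν_k ≤ C`, then `∫ e^{zu} dν_k → ∫ e^{zu} dν` for every complex `z`.
[Newman 1974, proof of Thm. 3] [folklore] -/
theorem tendsto_integral_cexp_of_tendsto {νs : ℕ → ProbabilityMeasure ℝ} {ν : ProbabilityMeasure ℝ}
    (hlim : Tendsto νs atTop (𝓝 ν)) {C : ℝ}
    (hint : ∀ k, Integrable (fun u => Real.exp (u ^ 2)) (νs k : Measure ℝ))
    (hC : ∀ k, ∫ u, Real.exp (u ^ 2) ∂(νs k : Measure ℝ) ≤ C) (z : ℂ) :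
    Tendsto (fun k => ∫ u, cexp (z * u) ∂(νs k : Measure ℝ)) atTop
      (𝓝 (∫ u, cexp (z * u) ∂(ν : Measure ℝ))) :=
  tendsto_integral_of_tendsto_of_exp_sq_bound hlim hint hC (by fun_prop) (norm_cexp_mul_ofReal_le z)

/-- **Equi-Lipschitz bound for Laplace transforms** on the ball of radius `B`, in terms of the
`e^{u²}`-moment. [folklore] -/
theorem norm_integral_cexp_sub_le (μ : Measure ℝ) (hI : Integrable (fun u => Real.exp (u ^ 2)) μ)
    {C : ℝ} (hC : ∫ u, Real.exp (u ^ 2) ∂μ ≤ C) {B : ℝ} {z z' : ℂ} (hz : ‖z‖ ≤ B) (hz' : ‖z'‖ ≤ B) :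
    ‖(∫ u, cexp (z * u) ∂μ) - ∫ u, cexp (z' * u) ∂μ‖ ≤
      ‖z - z'‖ * (Real.exp ((3 * B + 1) ^ 2 / 4) * C) := by
  have hdom : ∀ (v : ℂ), ‖v‖ ≤ B → ∀ u : ℝ, ‖cexp (v * u)‖ ≤ Real.exp (B ^ 2 / 4) * Real.exp (u ^ 2) := by
    intro v hv u
    refine (norm_cexp_mul_ofReal_le v u).trans ?_
    refine le_trans (Real.exp_le_exp.2 (mul_le_mul_of_nonneg_right
      ((Complex.abs_re_le_norm v).trans hv) (abs_nonneg u))) (exp_mul_abs_le B u)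
  have hIv : ∀ (v : ℂ), ‖v‖ ≤ B → Integrable (fun u : ℝ => cexp (v * u)) μ := fun v hv =>
    (hI.const_mul _).mono' (by fun_prop : Continuous fun u : ℝ => cexp (v * u)).aestronglyMeasurable
      (Eventually.of_forall (hdom v hv))
  rw [← integral_sub (hIv z hz) (hIv z' hz')]
  calc ‖∫ u, (cexp (z * u) - cexp (z' * u)) ∂μ‖ ≤ ∫ u, ‖cexp (z * u) - cexp (z' * u)‖ ∂μ :=
        norm_integral_le_integral_norm _
    _ ≤ ∫ u, ‖z - z'‖ * (Real.exp ((3 * B + 1) ^ 2 / 4) * Real.exp (u ^ 2)) ∂μ :=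
        integral_mono ((hIv z hz).sub (hIv z' hz')).norm ((hI.const_mul _).const_mul _)
          fun u => norm_cexp_mul_sub_cexp_mul_le hz hz' u
    _ = ‖z - z'‖ * (Real.exp ((3 * B + 1) ^ 2 / 4) * ∫ u, Real.exp (u ^ 2) ∂μ) := by
        rw [integral_const_mul, integral_const_mul]
    _ ≤ ‖z - z'‖ * (Real.exp ((3 * B + 1) ^ 2 / 4) * C) := by gcongr

/-- **Locally uniform convergence of Laplace transforms along an Ising limit** (pointwise
convergence + equi-Lipschitz bounds on balls). [Newman 1974, proof of Thm. 3] [folklore] -/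
theorem tendstoLocallyUniformlyOn_integral_cexp {νs : ℕ → ProbabilityMeasure ℝ}
    {ν : ProbabilityMeasure ℝ} (hlim : Tendsto νs atTop (𝓝 ν)) {C : ℝ}
    (hint : ∀ k, Integrable (fun u => Real.exp (u ^ 2)) (νs k : Measure ℝ))
    (hC : ∀ k, ∫ u, Real.exp (u ^ 2) ∂(νs k : Measure ℝ) ≤ C) {U : Set ℂ} (hU : IsOpen U) :
    TendstoLocallyUniformlyOn (fun k z => ∫ u, cexp (z * u) ∂(νs k : Measure ℝ))
      (fun z => ∫ u, cexp (z * u) ∂(ν : Measure ℝ)) atTop U := by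
  refine (tendstoLocallyUniformlyOn_iff_forall_isCompact hU).2 fun K _ hK => ?_
  obtain ⟨B, hB⟩ := hK.isBounded.subset_closedBall 0
  have hC0 : 0 ≤ C := le_trans (integral_nonneg fun u => (Real.exp_pos _).le) (hC 0)
  set Lip : ℝ := Real.exp ((3 * B + 1) ^ 2 / 4) * C + 1 with hLip
  have hLpos : 0 < Lip := by positivity
  refine tendstoUniformlyOn_of_lipschitz_of_tendsto hK hLpos (fun k z hz z' hz' => ?_)
    fun z _ => tendsto_integral_cexp_of_tendsto hlim hint hC z
  have hzB : ‖z‖ ≤ B := by simpa using hB hz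
  have hz'B : ‖z'‖ ≤ B := by simpa using hB hz'
  rw [dist_eq_norm, dist_eq_norm]
  calc ‖(∫ u, cexp (z * u) ∂(νs k : Measure ℝ)) - ∫ u, cexp (z' * u) ∂(νs k : Measure ℝ)‖
      ≤ ‖z - z'‖ * (Real.exp ((3 * B + 1) ^ 2 / 4) * C) :=
        norm_integral_cexp_sub_le _ (hint k) (hC k) hzB hz'B
    _ ≤ ‖z - z'‖ * Lip := by gcongr; rw [hLip]; linarith
    _ = Lip * ‖z - z'‖ := mul_comm _ _


end Literature.Probability.LatticeModels
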